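import Summits.BirchSwinnertonDyer.BirchSwinnertonDyer.Theorems.BiquadraticEisensteinDescentHeegnerTwistCouplingInSupplyKrizLiGrossCornerII
import Summits.BirchSwinnertonDyer.BirchSwinnertonDyer.Theorems.PrintCFramBottomClassIndexLawFiveLeKrizLi4HeegnerHypothesis
import Summits.BirchSwinnertonDyer.BirchSwinnertonDyer.Theorems.PrintCFramBottomClassIndexLawFiveLeKrizLi4CertKit
import Mathlib.Tactic.NormNum.LegendreSymbol
import HarnessLib

set_option linter.dupNamespace false -- `Summit.BirchSwinnertonDyer.BirchSwinnertonDyer.Theorems.…` (summit = sub, D-0017)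
set_option autoImplicit false

/-!
# Crux `HeegnerTwistCouplingInSupply` (stmt-BirchSwinnertonDyer-21381) — the GROSS-CURVE Kriz–Li corner FROM TWO CERTIFICATES:
# one theorem per CM base `A` and Eisenstein prime `q`, whose only per-class inputs are the two Bernoulli-unit certificates and decidable
# splitting / size conditions (part IX of `…KrizLiGrossCorner*`)

Route `BiquadraticEisensteinDescent` (cell `pub/bsd-wall`, width seat `bsd-wall-cm-bed-w4` g28; `--supports` 21381, helper). Parts I–VIII landed the
corner of crux 21381 on the Gross-curve classes `W ∼ A(q)^{(e)}` (`q ∈ {11, 19, 43, 67, 163}`) row by row. THIS FILE states the corner ONCE, in the shape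
of `KrizLiCornerQT27.exists_cruxConclusion_of_prime_pair` (the `j = 0` analogue): for an odd prime `q ≥ 5`, a CM base curve `A` with `q` CM-ramified,
good away from `q`, with trace form `a_ℓ(A) ≡ ℓ^k + ℓ^{q−k} (mod q)` (`2 ≤ k ≤ q − 2`), a class `W ∼ W₁ ≅ A^{(e)}` with `e ≡ 1 (mod 4)` squarefree, `q ∤ e`,
`J(|e| − 1 | |e|)·(−1)^k = −1` (i.e. `ψ = χ_e ω^k` odd), a prime `r ≡ 3 (mod 4)`, `r > 4`, `r ∤ e`, `r ≠ q`, with `J(−r | ℓ) = 1` for `ℓ = q` and every prime `ℓ ∣ e` (so `K′ = ℚ(√−r)` is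
Heegner for `N_W`), a kernel class number `h(−r) = h < p`, and the TWO UNIT CERTIFICATES of Kriz–Li's hypothesis (4) at `p_KL = q`
(`‖B_{1,θ₁}‖_q = 1` for every `θ₁` mod `q|e|` with values `J(j | |e|)·ω(j)^{q−1−k}`, `‖B_{1,θ₂}‖_q = 1` for every `θ₂` mod `q|e|r` with values
`J(j | |e|)·J(j | r)·ω(j)^{k−1}`, for every Teichmüller `ω`):

* ★ `exists_cruxConclusion_of_certificates` — **the CONCLUSION of crux 21381 at `(W, p)`**: `∃ K′` imaginary quadratic (`= ℚ(√−r)`, produced by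
  `SylvesterCorner.exists_field_of_odd`), `4 < |d_{K′}|`, Heegner for `N_W`, `L(W^{(d_{K′})}, 1) ≠ 0`, `p ∤ h(K′)` — for every globally minimal member `W`
  with `r_an(W) ≠ 0`, MODULO `hKL` (Kriz–Li 1.20), `hGZ`, `hHP` ONLY. Chain: cfram's engine `KrizLiBindersTwisted.krizLi_characterBernoulliBlock_twist_odd`
  (character ∧ `ε_K` ∧ (4) block from the certificates), cfram's `satisfiesHeegnerHypothesis_of_twist_emod_four`, part II's `cruxConclusion_of_block`
  (part I's `q`-generic modularity-free door).
* ★ `cruxConclusion_A11e193` — a NEW row through it: `A(11)^{(193)}` at the inert crux prime `193` (`K'' = ℚ(√−7)`), with its two kernel certificates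
  `certSum1/2_A11e193` (`11 ∥ S`; cfram's kit `KrizLi4Cert.norm_generalizedBernoulli_eq_one_of_table`, tables `KrizLiBinders.teichmullerPowTable_11_7/_11_2`).

So on each of the five Gross-curve habitats the crux at `(W, p)`, `p ∣ e` inert, is reduced to TWO kernel-decidable Bernoulli units plus a Heegner prime `r`
with `h(−r) < p` — the exact analogue of `(S3′)(p)` for `j = 0` (KL3-CORNERS-bsd-idea-18-g21 §2): uniform in nothing, decidable in everything.

HONEST FRAMING: corner layer; the certificates depend on `e ∋ p` (no uniformity in `p`; KL-irregular classes exist, e.g. `A(11)^{(293)}`); C⁺, the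
registered stubs of 21381, crux 21381 itself and BSD are NOT proved. THEOREMS ONLY. Supports stmt-BirchSwinnertonDyer-21381.
[cite: KrizLi2019, Thm. 1.20 (pp. 7–8), §1.5 (1), Rem. 1.21, §2] [cite: GrossZagier1986, Thm. I.(6.3), V.§1–2] [cite: GrossLMS1991, §1]
[cite: Cox2013, §1.C Lemma 1.14 and (1.18), §2.A Thm. 2.13, §7.B Thm. 7.7(ii)] [cite: Washington1997, §5.1, Thm. 4.2]
-/

noncomputable section

open scoped Classical NumberTheorySymbols

namespace Summit.BirchSwinnertonDyer.BirchSwinnertonDyer.Theorems.KrizLiGrossCorner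

open _root_.WeierstrassCurve NumberField DirichletCharacter
open Literature.NumberTheory.EllipticCurves Literature.NumberTheory.EllipticCurves.KrizLi2019 Literature.NumberTheory.LFunctions
  Literature.NumberTheory.EllipticCurves.ModularForms Literature.NumberTheory.EllipticCurves.Rank1Residual
  Literature.NumberTheory.QuadraticFields Literature.NumberTheory.QuadraticFields.Quadratic
  Summit.BirchSwinnertonDyer.Rank1Residual Summit.BirchSwinnertonDyer.Rank1Residual.X12.O11
  Summit.BirchSwinnertonDyer.Rank1Residual.X12.O11.RouteU
  Summit.BirchSwinnertonDyer.BirchSwinnertonDyer.Theorems.PrintCFram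
  Summit.BirchSwinnertonDyer.BirchSwinnertonDyer.Theorems.PrintCFram.KrizLiBindersTwisted

/-- ★ **The Gross-curve Kriz–Li corner of crux 21381 from two certificates.** See the module docstring: for `q ≥ 5` prime, a CM base `A`
(`q` CM-ramified, good away from `q`, trace form `ℓ^k + ℓ^{q−k}`), a class `W ∼ W₁ ≅ A^{(e)}` (`e ≡ 1 (mod 4)` squarefree, `q ∤ e`,
`J(|e|−1 | |e|)(−1)^k = −1`), a Heegner prime `r ≡ 3 (mod 4)`, `4 < r`, `r ≠ q`, `r ∤ e`, with `J(−r | q) = 1` and `J(−r | ℓ) = 1` at every prime `ℓ ∣ e`,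
`h(−r) = h < p`, and the two Bernoulli-unit certificates at `p_KL = q`: the CONCLUSION of crux 21381 at `(W, p)` for every globally minimal member with
`r_an(W) ≠ 0`, modulo `hKL`, `hGZ`, `hHP`. [cite: KrizLi2019, Thm. 1.20 (pp. 7–8), Rem. 1.21, §2] [cite: Cox2013, §1.C (1.18), §2.A Thm. 2.13, §7.B Thm. 7.7(ii)] -/
theorem exists_cruxConclusion_of_certificates {q : ℕ} [hq : Fact q.Prime] (hq5 : 5 ≤ q)
    (hKL : thm120_padicLogHeegner_unit_of_bernoulli)
    (hGZ : ∀ (N : ℕ) [NeZero N] (W : WeierstrassCurve ℚ) (K : Type) [Field K] [NumberField K], gross_zagier N W K)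
    (hHP : ∀ (W : WeierstrassCurve ℚ) (K : Type) [Field K] [NumberField K], exists_isHeegnerPoint W K)
    (A : WeierstrassCurve ℚ) [A.IsElliptic] (hA : A.HasCM) (hAq : CMRamified A q) {k : ℕ} (hk2 : 2 ≤ k) (hkq : k ≤ q - 2)
    (hgood : ∀ (ℓ : ℕ) [Fact ℓ.Prime], ℓ ≠ q → A.HasGoodReductionAtPrime ℓ)
    (hbase : ∀ (ℓ : ℕ) [Fact ℓ.Prime], ℓ ≠ q → (A.LFunction ℓ : ZMod q) = (ℓ : ZMod q) ^ k + (ℓ : ZMod q) ^ (q - k))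
    (W W₁ : WeierstrassCurve ℚ) [W.IsElliptic] [W.IsGloballyMinimal] [NeZero (W.conductorNorm ℤ)] [W₁.IsElliptic]
    (hiso : IsIsogenous W W₁) {e : ℤ} (he4 : e % 4 = 1) (hsq : Squarefree e) (hqe : ¬ (q : ℤ) ∣ e) [NeZero e.natAbs]
    (hW₁ : ∃ C : VariableChange ℚ, C • W₁ = A.quadraticTwist ((e : ℤ) : ℚ))
    (hpar : J(((e.natAbs - 1 : ℕ) : ℤ) | e.natAbs) * (-1 : ℤ) ^ k = -1)
    {r : ℕ} [hr : Fact r.Prime] (hr4 : r % 4 = 3) (hr5 : 4 < r) (hrq : r ≠ q) (hre : ¬ (r : ℤ) ∣ e)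
    (hsplit : ∀ ℓ : ℕ, ℓ.Prime → (ℓ = q ∨ (ℓ : ℤ) ∣ e) → J((-(r : ℤ)) | ℓ) = 1)
    {h p : ℕ} (hclass : BinQF.classNumber (-(r : ℤ)) = h) (hhp : h < p)
    (hcert₁ : ∀ (ω : DirichletCharacter ℚ_[q] q), IsTeichmullerCharacter ω →
      ∀ θ₁ : DirichletCharacter ℚ_[q] (q * e.natAbs),
        (∀ j : ZMod (q * e.natAbs), θ₁ j = (J((j.val : ℤ) | e.natAbs) : ℚ_[q]) * ω (j.val : ZMod q) ^ (q - 1 - k)) →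
        ‖generalizedBernoulli 1 θ₁‖ = 1)
    (hcert₂ : ∀ (ω : DirichletCharacter ℚ_[q] q), IsTeichmullerCharacter ω →
      ∀ θ₂ : DirichletCharacter ℚ_[q] (q * (e.natAbs * r)),
        (∀ j : ZMod (q * (e.natAbs * r)),
          θ₂ j = (J((j.val : ℤ) | e.natAbs) : ℚ_[q]) * (J((j.val : ℤ) | r) : ℚ_[q]) * ω (j.val : ZMod q) ^ (k - 1)) →
        ‖generalizedBernoulli 1 θ₂‖ = 1)
    (hr1 : W.analyticRank ≠ 0) :
    ∃ (K : Type) (_ : Field K) (_ : NumberField K),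
      IsImaginaryQuadratic K ∧ 4 < (NumberField.discr K).natAbs ∧
      SatisfiesHeegnerHypothesis (W.conductorNorm ℤ) K ∧
      (W.quadraticTwist (NumberField.discr K : ℚ)).entireLFunction 1 ≠ 0 ∧ ¬ p ∣ NumberField.classNumber K := by
  have hq2 : q ≠ 2 := by omega
  have he0 : e ≠ 0 := hsq.ne_zero
  have hr2 : r ≠ 2 := by omega
  have heodd : e % 2 = 1 := by omega
  refine cruxConclusion_of_block (q := q) hq5 hKL hGZ hHP A hA hAq W W₁ hiso he0 hW₁ hr1 (d := -(r : ℤ)) (h := h) (p := p)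
    (by have := hr.out.pos; omega) (by omega) (by rw [Int.natAbs_neg, Int.natAbs_natCast]; exact hr.out.prime.squarefree)
    (by rw [Int.natAbs_neg, Int.natAbs_natCast]; exact hr5) hclass hhp (fun K _ _ hK2 hdK => ?_) (fun K _ _ hK2 hdK => ?_)
  · -- the character ∧ `ε_K` ∧ Bernoulli block from the two certificates (cfram's twisted-member engine)
    intro _
    obtain ⟨ω, hω⟩ := exists_isTeichmullerCharacter (p := q)
    obtain ⟨εK, hεK, hεKval⟩ := KrizLiBinders.exists_isKroneckerCharacterOf_of_discr (p := q) hK2 hr.out.prime.squarefree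
      (Or.inr ⟨hdK, hr4⟩)
    have hd : (NumberField.discr K).natAbs = r := by rw [hdK, Int.natAbs_neg, Int.natAbs_natCast]
    obtain ⟨χ, hχ⟩ := KrizLiBinders.exists_jacobiCharPadic (p := q) e.natAbs
    have hpar' : χ (-1) * (-1) ^ k = -1 := by
      -- `χ(−1) = χ(|e| − 1) = J(|e| − 1 | |e|)`
      have h1le : 1 ≤ e.natAbs := Nat.one_le_iff_ne_zero.mpr (NeZero.ne _)
      have hcast : ((e.natAbs - 1 : ℕ) : ZMod e.natAbs) = -1 := by
        rw [Nat.cast_sub h1le, ZMod.natCast_self, Nat.cast_one, zero_sub]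
      rw [← hcast, hχ (e.natAbs - 1)]
      exact_mod_cast hpar
    obtain ⟨f, hf, ψ, hprim, hodd, hss, h1, h3, h4⟩ :=
      krizLi_characterBernoulliBlock_twist_odd (p := q) hq2 A hk2 hkq (fun r _ hr => hgood r hr)
        (fun ℓ _ hℓ => hbase ℓ hℓ) W W₁ hiso he4 hsq hqe hW₁ χ hχ hpar' ω hω (q := r) hrq hr2 hre hd εK hεKval
        (fun θ₁ hθ₁ => hcert₁ ω hω θ₁ hθ₁)
        (fun θ₂ hθ₂ => hcert₂ ω hω θ₂ (fun j => by
          have hj : θ₂ j = (J((j.val : ℤ) | e.natAbs * r) : ℚ_[q]) * ω (j.val : ZMod q) ^ (k - 1) := hθ₂ j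
          refine hj.trans ?_
          rw [RouteU.jacobiSym_mul_right' _ (NeZero.ne _) hr.out.ne_zero]; push_cast; ring))
    exact ⟨f, hf, ψ, ω, εK, hprim, hω, hss, h1, h3, hεK, by exact_mod_cast h4, hodd⟩
  · -- the Heegner hypothesis from the splitting of `q` and of the primes of `e` in `ℚ(√−r)`
    refine satisfiesHeegnerHypothesis_of_twist_emod_four A (fun r _ hr => hgood r hr) W W₁ hiso he4 hW₁ K (fun ℓ hℓ hℓ' => ?_)
    have hℓ2 : ℓ ≠ 2 := by
      rcases hℓ' with rfl | hd
      · exact hq2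
      · rintro rfl
        have : (2 : ℤ) ∣ e := hd
        omega
    rw [Quadratic.ncard_primesOver_eq_two_iff_jacobiSym hK2 hℓ hℓ2, hdK]
    exact hsplit ℓ hℓ hℓ'

/-! ## A new row through the certificate API: `A(11)^{(193)}` at `193`, `K'' = ℚ(√−7)` -/

/-! ## Class `A11e193` = `A(11)^{(193)}` : `ψ = χ_{193}·ω^{3}` (odd twisting discriminant), `K'' = ℚ(√-7)`, crux prime `p = 193` -/

set_option maxRecDepth 400000 in
/-- Certificate sum for `θ₁` of `A11e193`: `S = Σ_{j<2123} χ(j)·t(j mod 11)·j = 112519` (`11 ∥ S`), Jacobi symbols by Euler's criterion in `ℕ`,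
`decide +kernel`. [cite: KrizLi2019, §1.5 display (1) (p. 7)] -/
theorem certSum1_A11e193 :
    ∑ j ∈ Finset.range (11 * 193), (J((j : ℤ) | 193) * ((([0, 1, 40, 9, 27, 3, 118, 94, 112, 81, 120] : List ℕ).getD (j % 11) 0 : ℕ) : ℤ)) * (j : ℤ) ^ (0 + 1) = 112519 := by
  simp_rw [RouteU.jacobiSym_prime_eq_ite_nat 193 (by norm_num) (by norm_num)]
  decide +kernel

/-- **`‖B_{1,θ₁}‖_{11} = 1` for the class `A11e193`** (`A(11)^{(193)}`): for every Teichmüller `ω` mod `11` and every `ℚ_11`-valued `θ₁`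
mod `11·193` with values `χ_{193}(j)·ω(j)^{7}` (`= ψ⁻¹`, `ψ = χ_{193}·ω^{3}`), `B_{1,θ₁}` is a `11`-adic unit — the CLASS FACTOR of
Kriz–Li's (4). Witness of `θ ≠ 1`: `θ(34) = −1`. [cite: KrizLi2019, Thm. 1.20 (p. 8, hypothesis (4)) and §1.5 (1) (p. 7)]
[cite: Washington1997, §5.1 and Thm. 4.2] -/
theorem norm_generalizedBernoulli_theta1_A11e193 [Fact (Nat.Prime 11)] (ω : DirichletCharacter ℚ_[11] 11)
    (hω : IsTeichmullerCharacter ω) (θ : DirichletCharacter ℚ_[11] (11 * 193))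
    (hθ : ∀ j : ZMod (11 * 193), θ j = (J((j.val : ℤ) | 193) : ℚ_[11]) * ω (j.val : ZMod 11) ^ 7) :
    ‖generalizedBernoulli 1 θ‖ = 1 :=
  @KrizLi4Cert.norm_generalizedBernoulli_eq_one_of_table 11 193 _ ⟨by norm_num⟩ ω hω 7 (by norm_num)
    (KrizLi4Cert.padicValNat_mul_eq_one (by norm_num)) (fun a => J((a : ℤ) | 193)) θ
    (fun j => by rw [hθ j]) 34 (by norm_num) (by norm_num) (by norm_num) (by norm_num)
    (fun j => ([0, 1, 40, 9, 27, 3, 118, 94, 112, 81, 120] : List ℕ).getD j 0) rfl KrizLiBinders.teichmullerPowTable_11_7 (112519) certSum1_A11e193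
    (by norm_num) (by norm_num)

set_option maxRecDepth 400000 in
/-- Block 0 (`0 ≤ j < 10000`) of the certificate sum for `θ₂` of `A11e193` (`decide +kernel`). [cite: KrizLi2019, §1.5 display (1) (p. 7)] -/
theorem certSum2_A11e193_block0 :
    ∑ j ∈ Finset.Ico (0 : ℕ) 10000, (J((j : ℤ) | 193) * J((j : ℤ) | 7) * ((([0, 1, 81, 9, 27, 3, 3, 27, 9, 81, 1] : List ℕ).getD (j % 11) 0 : ℕ) : ℤ)) * (j : ℤ) ^ (0 + 1) = 3143754 := by
  simp_rw [RouteU.jacobiSym_prime_eq_ite_nat 193 (by norm_num) (by norm_num), RouteU.jacobiSym_prime_eq_ite_nat 7 (by norm_num) (by norm_num)]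
  decide +kernel

set_option maxRecDepth 400000 in
/-- Block 1 (`10000 ≤ j < 14861`) of the certificate sum for `θ₂` of `A11e193` (`decide +kernel`). [cite: KrizLi2019, §1.5 display (1) (p. 7)] -/
theorem certSum2_A11e193_block1 :
    ∑ j ∈ Finset.Ico (10000 : ℕ) (11 * 1351), (J((j : ℤ) | 193) * J((j : ℤ) | 7) * ((([0, 1, 81, 9, 27, 3, 3, 27, 9, 81, 1] : List ℕ).getD (j % 11) 0 : ℕ) : ℤ)) * (j : ℤ) ^ (0 + 1) = 14095006 := by
  simp_rw [RouteU.jacobiSym_prime_eq_ite_nat 193 (by norm_num) (by norm_num), RouteU.jacobiSym_prime_eq_ite_nat 7 (by norm_num) (by norm_num)]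
  decide +kernel

/-- The certificate sum for `θ₂` of `A11e193` assembled from its 2 block(s): `S = Σ_{j<14861} χ(j)·t(j mod 11)·j = 17238760` (`11 ∥ S`).
[cite: KrizLi2019, §1.5 display (1) (p. 7)] -/
theorem certSum2_A11e193 :
    ∑ j ∈ Finset.range (11 * 1351), (J((j : ℤ) | 193) * J((j : ℤ) | 7) * ((([0, 1, 81, 9, 27, 3, 3, 27, 9, 81, 1] : List ℕ).getD (j % 11) 0 : ℕ) : ℤ)) * (j : ℤ) ^ (0 + 1) = 17238760 := by
  rw [Finset.range_eq_Ico,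
    ← Finset.sum_Ico_consecutive _ (show 0 ≤ 10000 by norm_num) (show 10000 ≤ 11 * 1351 by norm_num),
    certSum2_A11e193_block0, certSum2_A11e193_block1]
  norm_num

/-- **`‖B_{1,θ₂}‖_{11} = 1` for the class `A11e193` over `K'' = ℚ(√-7)`**: for every Teichmüller `ω` mod `11` and every `ℚ_11`-valued `θ₂`
mod `11·1351` with values `χ_{193}(j)·(j/7)·ω(j)^{2}` (`= ψ·ε_K·ω⁻¹`), `B_{1,θ₂}` is a `11`-adic unit — the `K''`-FACTOR of Kriz–Li's (4).
Witness of `θ ≠ 1`: `θ(12) = −1`. [cite: KrizLi2019, Thm. 1.20 (p. 8, hypothesis (4)) and §1.5 (1) (p. 7)] [cite: Washington1997, §5.1 and Thm. 4.2] -/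
theorem norm_generalizedBernoulli_theta2_A11e193 [Fact (Nat.Prime 11)] (ω : DirichletCharacter ℚ_[11] 11)
    (hω : IsTeichmullerCharacter ω) (θ : DirichletCharacter ℚ_[11] (11 * 1351))
    (hθ : ∀ j : ZMod (11 * 1351), θ j = (J((j.val : ℤ) | 193) : ℚ_[11]) * (J((j.val : ℤ) | 7) : ℚ_[11]) * ω (j.val : ZMod 11) ^ 2) :
    ‖generalizedBernoulli 1 θ‖ = 1 :=
  @KrizLi4Cert.norm_generalizedBernoulli_eq_one_of_table 11 1351 _ ⟨by norm_num⟩ ω hω 2 (by norm_num)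
    (KrizLi4Cert.padicValNat_mul_eq_one (by norm_num)) (fun a => J((a : ℤ) | 193) * J((a : ℤ) | 7)) θ
    (fun j => by rw [hθ j]; push_cast; ring) 12 (by norm_num) (by norm_num) (by norm_num) (by norm_num)
    (fun j => ([0, 1, 81, 9, 27, 3, 3, 27, 9, 81, 1] : List ℕ).getD j 0) rfl KrizLiBinders.teichmullerPowTable_11_2 (17238760) certSum2_A11e193
    (by norm_num) (by norm_num)


set_option maxRecDepth 20000 in
/-- ★ **`A11e193 = A(11)^{(193)}`, crux prime `p = 193`, THROUGH `exists_cruxConclusion_of_certificates`** (`193 ≡ 6 (mod 11)` is INERT in `ℚ(√−11)`;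
`K′ = ℚ(√−7)`, `h = 1`; certificates `norm_generalizedBernoulli_theta1/2_A11e193` above): for every globally minimal `W` `ℚ`-isogenous to a curve
`ℚ`-isomorphic to `cm11.quadraticTwist 193` with `r_an(W) ≠ 0`, the CONCLUSION of crux 21381 at `(W, 193)`, modulo `hKL`, `hGZ`, `hHP`.
[cite: KrizLi2019, Thm. 1.20 (pp. 7–8)] [cite: Cox2013, §2.A Thm. 2.13] -/
theorem cruxConclusion_A11e193 (hKL : thm120_padicLogHeegner_unit_of_bernoulli)
    (hGZ : ∀ (N : ℕ) [NeZero N] (W : WeierstrassCurve ℚ) (K : Type) [Field K] [NumberField K], gross_zagier N W K)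
    (hHP : ∀ (W : WeierstrassCurve ℚ) (K : Type) [Field K] [NumberField K], exists_isHeegnerPoint W K)
    (W W₁ : WeierstrassCurve ℚ) [W.IsElliptic] [W.IsGloballyMinimal] [NeZero (W.conductorNorm ℤ)] [W₁.IsElliptic]
    (hiso : IsIsogenous W W₁) (hW₁ : ∃ C : VariableChange ℚ, C • W₁ = cm11.quadraticTwist ((193 : ℤ) : ℚ))
    (hr : W.analyticRank ≠ 0) :
    ∃ (K : Type) (_ : Field K) (_ : NumberField K),
      IsImaginaryQuadratic K ∧ 4 < (NumberField.discr K).natAbs ∧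
      SatisfiesHeegnerHypothesis (W.conductorNorm ℤ) K ∧
      (W.quadraticTwist (NumberField.discr K : ℚ)).entireLFunction 1 ≠ 0 ∧ ¬ 193 ∣ NumberField.classNumber K := by
  haveI : Fact (Nat.Prime 11) := ⟨by norm_num⟩
  haveI : Fact (Nat.Prime 7) := ⟨by norm_num⟩
  haveI : NeZero ((193 : ℤ)).natAbs := ⟨by decide⟩
  refine exists_cruxConclusion_of_certificates (q := 11) (by norm_num) hKL hGZ hHP cm11 KrizLiBinders.hasCM_bases.2.1
    KrizLiBinders.cmRamified_bases.2.1 (k := 3) (by norm_num) (by norm_num)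
    (fun ℓ _ hℓ => EisensteinTraceForm.hasGoodReductionAtPrime_cm11 ℓ hℓ)
    (fun ℓ _ hℓ => by simpa using EisensteinTraceForm.lFunction_cm11_mod ℓ hℓ) W W₁ hiso (e := 193) (by norm_num)
    (by rw [← Int.squarefree_natAbs]; exact (Nat.Prime.prime (by norm_num : Nat.Prime 193)).squarefree) (by norm_num) hW₁
    (show J(((193 - 1 : ℕ) : ℤ) | 193) * (-1 : ℤ) ^ 3 = -1 by norm_num) (r := 7) (by norm_num) (by norm_num) (by norm_num) (by norm_num)
    (fun ℓ hℓ hℓ' => ?_) (h := 1) (p := 193) (by decide +kernel) (by norm_num)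
    (fun ω hω θ₁ hθ₁ => norm_generalizedBernoulli_theta1_A11e193 ω hω θ₁ hθ₁)
    (fun ω hω θ₂ hθ₂ => norm_generalizedBernoulli_theta2_A11e193 ω hω θ₂ hθ₂) hr
  -- splitting of `11` and `193` in `ℚ(√−7)`
  have hcases : ℓ = 11 ∨ ℓ = 193 := by
    rcases hℓ' with h | hd
    · exact Or.inl h
    · exact Or.inr ((Nat.prime_dvd_prime_iff_eq hℓ (by norm_num : Nat.Prime 193)).mp (by exact_mod_cast hd))
  rcases hcases with rfl | rfl <;> norm_num

end Summit.BirchSwinnertonDyer.BirchSwinnertonDyer.Theorems.KrizLiGrossCorner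

end
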